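/-
Copyright (c) 2026 the pub-hodgecm-mathlib formalisation cell (harness21).  Prover seat hodgecm-mathlib-F0P2-p02 (g26); E1 keeper ∕ dealer F0P3a-p03 (g29), E1 BRICK LEDGER
row 46 «K4′ SELF-EXTENSION ASSEMBLY modulo JET @ DATUM», generic spine G3 (census `F0/P2/p02/g26/k4prime/CENSUS-K4PRIME-SELFEXT.v1` ec9d9e16).
-/
import Literature.RepresentationTheory.SelfExtensionSplitting     -- ★ G2 p853262: `forall_apply_mem_of_selfExtension`, `exists_section_of_two_le_finrank` (brings ★ G1 `JetEmbeddingExclusion`)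
import Literature.RepresentationTheory.FirstOrderJetIntertwiner   -- ★ JET-SIGN p852846: `exists_intertwiningMap_jet_sign`
import HarnessLib

/-!
# Self-extensions of `A = ker(𝒜₀ − 1) ≤ π₀` SPLIT when the jet module carries a `G`-endomorphism acting by `+1` over `A` on the quotient and by `−1` on the sub copy of `A`
# (the «jet sign» of a jet intertwiner `(𝒜₀, 𝒜₁)`), as soon as `dim Hom_G(X, π₀) ≥ 2` or `X` maps into the jet meeting both the quotient and the sub non-trivially

Generic representation theory over a field `k` with `2 ≠ 0` (any monoid `G`), THEOREMS ONLY (no `def`, no instance, no notation, no named fact, no `sorry`), on top of the tree's ★ G2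
`SelfExtensionSplitting` (row 40; brings ★ G1 `JetEmbeddingExclusion`, ★ row 24, ★ HOM-COUNT-SPLIT) and ★ JET-SIGN `FirstOrderJetIntertwiner`.  Letters of ★ G1∕G2 VERBATIM:
`π₀ : Representation k G V`, the jet module `ρ` of a first-order deformation `π₁` (`hρ : ρ g (v₀, v₁) = (π₀ g v₀, π₁ g v₀ + π₀ g v₁)`), `A : Submodule k V` (`hAinv`, `hAirr`),
`hHom0 : Hom_G(A, V ∕ A) = 0`, Schur `hSchur`, the self-extension `(τ, ι, p, hp, hexact)` of `A`; NEW hypothesis-style letters: a `G`-endomorphism of the jet module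
**`Φ : IntertwiningMap ρ ρ` with `hΦfst : ∀ v, v.1 ∈ A → (Φ v).1 = v.1` and `hΦsub : ∀ w ∈ A, Φ (0, w) = (0, -w)`** — the JET SIGN of ★ `FirstOrderJetIntertwiner`
(`Φ (v₀, v₁) = (𝒜₀ v₀, −(𝒜₁ v₀ + 𝒜₀ v₁))` for a jet intertwiner `(𝒜₀, 𝒜₁)`, with `𝒜₀ = 1` on `A`; §3).

* §1 **THE DEVICE** (`two_le_finrank_intertwiningMap_of_jet_sign`): for an equivariant `φ : X → V × V` lying in the WINDOW over `A` (`hA : (φ x).1 ∈ A`, `hmeet : (φ x).1 = 0 → (φ x).2 ∈ A`)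
  which meets the quotient (`∃ x₀, (φ x₀).1 ≠ 0`) AND the sub (`∃ x₁, (φ x₁).1 = 0 ∧ (φ x₁).2 ≠ 0`), the two `G`-maps `f₁ := fst ∘ φ` and `f₂ := snd ∘ (Φ ∘ φ − φ)` (`Φ ∘ φ − φ` has
  first component `0`, so its second component is equivariant — ★ G1 §1) are LINEARLY INDEPENDENT in `Hom_G(X, V)`: `f₁ x₁ = 0`, `f₂ x₁ = −2 (φ x₁).2 ≠ 0`, `f₁ x₀ ≠ 0`.
  Hence `2 ≤ dim_k Hom_G(X, V)` (finite-dimensionality of `Hom_G(X, V)` a hypothesis — at the datum it is Frobenius reciprocity onto a `2`-dimensional Jacquet module).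
* §2 **THE ASSEMBLY** (`exists_section_of_two_le_finrank_or_exists_jet_sign`): a self-extension `0 → A → X → A → 0` of an irreducible invariant `A` with `Hom_G(A, V ∕ A) = 0` and Schur
  SPLITS as soon as «`2 ≤ dim Hom_G(X, V)` OR some equivariant `φ : X → V × V` meets quotient and sub non-trivially» — ★ G2 `forall_apply_mem_of_selfExtension` + ★ G1
  `window_of_forall_apply_mem` put any such `φ` in the window, §1 upgrades the second disjunct to the first, and ★ G2 `exists_section_of_two_le_finrank` concludes.  No (ND), no
  `π₁ 1 = 0` ∕ Leibniz, no `𝒜₁`: the jet-intertwiner relation is consumed once, by ★ JET-SIGN, to produce `Φ`.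
* §3 **IN JET-SIGN LETTERS** (`exists_section_of_two_le_finrank_or_exists_jet_of_jet_intertwiner`): the same with `(𝒜₀, 𝒜₁)` (`𝒜₀ π₀ = π₀ 𝒜₀`,
  `𝒜₁ π₀ g − π₀ g 𝒜₁ = −(π₁ g 𝒜₀ + 𝒜₀ π₁ g)`) and `A ≤ ker(𝒜₀ − 1)` (`hAfix : ∀ a ∈ A, 𝒜₀ a = a`), `Φ` := ★ `exists_intertwiningMap_jet_sign`.
  USE (row 46 datum file, census §0 D′): `G = U(Φ₃)(L⁺_v)`, `π₀ = I = i_B(θ̃)` reducible unitary principal series with its normalised intertwining involution `𝒜₀`, `A = π⁺ = ker(𝒜₀ − 1)`,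
  `V ∕ A ≅ π⁻`; for a smooth self-extension `E` of `π⁺`, `r_B E ∈ {θ̃ ⊕ θ̃, N_λ}`: Frobenius gives `dim Hom_G(E, I) = 2` in the first case and, in the second, `φ = Ψ ∘ adj(θ)` into the jet of
  `(I, π₁^Λ)` meeting quotient and sub (Frobenius naturality in both variables) — so `E` splits GIVEN the jet intertwiner `(𝒜₀, 𝒜₁)` (K4′-alg ⟸ (J)).

SOURCES (what is formalised, read at our letters).  [Keys1984, §3 pp. 118–119; §4 Thm. 3 p. 120, Remark p. 129]: the normalised intertwining operators `𝒜(w, χν^s)` of the unitary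
principal series of a rank-one unitary group, holomorphic and non-scalar at a reducibility point, the commuting algebra `ℂ[R]` and the constituents `π^±` as `±1`-eigenspaces — the
source of `(𝒜₀, 𝒜₁)` and of the sign device «an operator acting by opposite signs on the two copies of a constituent splits the extension»; [BernsteinZelevinsky1976, §2.1–§2.4,
2.8–2.9 p. 16] and [Casselman1995, §6.3–§6.4]: `Hom` bookkeeping for finite-length representations (the count `dim Hom ≥ 2 ⇒ split` is ★ HOM-COUNT-SPLIT ∕ ★ G2);
[Rogawski1990, §12.2 (3) p. 173]: the packets `{π⁺, π⁻} = JH(i_B θ̃)` where the consumer lives.  Deliberately NOT here: Jacquet modules, induction, the unitary group, or (J) itself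
(a hypothesis; [Keys1984] proves the regularity of `𝒜(w, ·)` at `s = 0` that produces `𝒜₁`).
HONEST LABEL: count-neutral generic layer; `Φ` ∕ `(𝒜₀, 𝒜₁)`, `hHom0`, Schur and the alternative are hypotheses; HC_CM is proved only modulo the printed citations until rung 0 closes.
-/

set_option autoImplicit false

namespace Literature.RepresentationTheory

open Representation

universe u v w w'

variable {k : Type u} [Field k] {G : Type v} [Monoid G]
  {V : Type w} [AddCommGroup V] [Module k V] {X : Type w'} [AddCommGroup X] [Module k X]

/-! ## §1 The device: two independent `G`-maps `X → V` from a window map meeting quotient and sub -/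

/-- **TWO INDEPENDENT `G`-MAPS FROM A JET SIGN.**  Let `Φ ∈ End_G(ρ)` act by `+1` over `A` on the quotient (`hΦfst`) and by `−1` on the sub copy of `A` (`hΦsub`), `2 ≠ 0` in `k`.
If an equivariant `φ : X → V × V` lies in the window over `A` (`hA`, `hmeet`), meets the quotient (`(φ x₀).1 ≠ 0`) and the sub (`(φ x₁).1 = 0`, `(φ x₁).2 ≠ 0`), then
`fst ∘ φ` and `snd ∘ (Φ ∘ φ − φ)` are linearly independent `G`-maps `X → V`, so `2 ≤ dim_k Hom_G(X, V)` (for `Hom_G(X, V)` finite-dimensional).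
[cite: Keys1984, §4 Thm. 3 p. 120 and Remark p. 129] [cite: BernsteinZelevinsky1976, §2.1–§2.4; 2.8–2.9 p. 16] -/
theorem two_le_finrank_intertwiningMap_of_jet_sign (π₀ : Representation k G V) (π₁ : G → Module.End k V) (ρ : Representation k G (V × V))
    (hρ : ∀ g v₀ v₁, ρ g (v₀, v₁) = (π₀ g v₀, π₁ g v₀ + π₀ g v₁)) (A : Submodule k V) (h2 : (2 : k) ≠ 0)
    (Φ : IntertwiningMap ρ ρ) (hΦfst : ∀ v : V × V, v.1 ∈ A → (Φ v).1 = v.1) (hΦsub : ∀ w ∈ A, Φ (0, w) = (0, -w))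
    (τ : Representation k G X) (φ : X →ₗ[k] V × V) (hφ : ∀ g x, φ (τ g x) = ρ g (φ x))
    (hA : ∀ x, (φ x).1 ∈ A) (hmeet : ∀ x, (φ x).1 = 0 → (φ x).2 ∈ A)
    (h₀ : ∃ x, (φ x).1 ≠ 0) (h₁ : ∃ x, (φ x).1 = 0 ∧ (φ x).2 ≠ 0) [FiniteDimensional k (IntertwiningMap τ π₀)] :
    2 ≤ Module.finrank k (IntertwiningMap τ π₀) := by
  obtain ⟨x₀, hx₀⟩ := h₀
  obtain ⟨x₁, hx₁, hx₁'⟩ := h₁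
  -- `f₁ := fst ∘ φ`
  let f₁ : IntertwiningMap τ π₀ := ((LinearMap.fst k V V) ∘ₗ φ).intertwiningMap_of_isIntertwiningMap τ π₀
    (fun g x => fst_apply_equivariant π₀ π₁ ρ hρ τ φ hφ g x)
  have hf₁ : ∀ x, f₁ x = (φ x).1 := fun x => rfl
  -- `φ' := Φ ∘ φ − φ` has first component `0`, so `f₂ := snd ∘ φ'` is a `G`-map
  let φ' : X →ₗ[k] V × V := Φ.toLinearMap ∘ₗ φ - φ
  have hφ'v : ∀ x, φ' x = Φ (φ x) - φ x := fun x => rfl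
  have hφ' : ∀ g x, φ' (τ g x) = ρ g (φ' x) := fun g x => by
    rw [hφ'v, hφ'v, hφ, map_sub, IntertwiningMap.isIntertwining _ _ Φ g (φ x)]
  have hφ'1 : ∀ x, (φ' x).1 = 0 := fun x => by
    rw [hφ'v, Prod.fst_sub, hΦfst _ (hA x), sub_self]
  let f₂ : IntertwiningMap τ π₀ := ((LinearMap.snd k V V) ∘ₗ φ').intertwiningMap_of_isIntertwiningMap τ π₀
    (fun g x => (snd_apply_equivariant_of_fst_eq_zero π₀ π₁ ρ hρ τ φ' hφ' g x (hφ'1 x)).2)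
  have hf₂ : ∀ x, f₂ x = (Φ (φ x) - φ x).2 := fun x => rfl
  -- the value of `f₂` at `x₁`: `φ x₁ = (0, w)` with `w ∈ A`, `Φ (0, w) = (0, -w)`
  have hφx₁ : φ x₁ = (0, (φ x₁).2) := Prod.ext hx₁ rfl
  have hf₂x₁ : f₂ x₁ = -(φ x₁).2 - (φ x₁).2 := by
    rw [hf₂]
    have hΦx₁ : Φ (φ x₁) = (0, -(φ x₁).2) := by
      rw [hφx₁, hΦsub _ (hmeet x₁ hx₁)]
    rw [hΦx₁, Prod.snd_sub]
  -- linear independence of `(f₁, f₂)`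
  have hli : LinearIndependent k ![f₁, f₂] := by
    refine LinearIndependent.pair_iff.2 fun s t hst => ?_
    have e₁ := congrArg (fun f : IntertwiningMap τ π₀ => f x₁) hst
    have e₀ := congrArg (fun f : IntertwiningMap τ π₀ => f x₀) hst
    simp only [IntertwiningMap.coe_add, IntertwiningMap.coe_smul, Pi.add_apply, Pi.smul_apply, IntertwiningMap.coe_zero,
      Pi.zero_apply] at e₀ e₁
    rw [hf₁, hx₁, smul_zero, zero_add, hf₂x₁] at e₁
    have ht : t = 0 := by
      by_contra ht
      apply hx₁'
      have hw : -(φ x₁).2 - (φ x₁).2 = 0 := (smul_eq_zero.1 e₁).resolve_left ht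
      have h2w : (2 : k) • (φ x₁).2 = 0 := by
        rw [two_smul, ← neg_eq_zero, neg_add', hw]
      exact (smul_eq_zero.1 h2w).resolve_left h2
    rw [ht, zero_smul, add_zero, hf₁] at e₀
    exact ⟨(smul_eq_zero.1 e₀).resolve_right hx₀, ht⟩
  have hcard := hli.fintype_card_le_finrank
  rwa [Fintype.card_fin] at hcard

/-! ## §2 The assembly: split by Hom-count, directly or via the jet sign -/

/-- **SELF-EXTENSIONS SPLIT FROM THE ALTERNATIVE, GIVEN A JET SIGN.**  Let `A ≤ π₀` be invariant and irreducible with `Hom_G(A, V ∕ A) = 0` and Schur `dim End_G(A) = 1`, let `ρ` be the jet module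
of `(π₀, π₁)` with a `G`-endomorphism `Φ` acting by `+1` over `A` on the quotient and by `−1` on the sub copy of `A`, `2 ≠ 0` in `k`.  A self-extension `0 → A → X → A → 0` with
`Hom_G(X, V)` finite-dimensional SPLITS as soon as `2 ≤ dim Hom_G(X, V)` OR some equivariant `φ : X → V × V` meets both the quotient and the sub (`(φ x₀).1 ≠ 0`; `(φ x₁).1 = 0`,
`(φ x₁).2 ≠ 0`): ★ G2 puts `φ` in the window over `A`, §1 gives `2 ≤ dim Hom_G(X, V)`, and ★ G2 `exists_section_of_two_le_finrank` concludes.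
[cite: Keys1984, §3 pp. 118–119; §4 Thm. 3 p. 120] [cite: BernsteinZelevinsky1976, §2.1–§2.4; 2.8–2.9 p. 16] [cite: Casselman1995, §6.3–§6.4] -/
theorem exists_section_of_two_le_finrank_or_exists_jet_sign (π₀ : Representation k G V) (π₁ : G → Module.End k V) (ρ : Representation k G (V × V))
    (hρ : ∀ g v₀ v₁, ρ g (v₀, v₁) = (π₀ g v₀, π₁ g v₀ + π₀ g v₁)) (A : Submodule k V) (h2 : (2 : k) ≠ 0)
    (hAinv : ∀ g, A ≤ A.comap (π₀ g))
    (hAirr : ∀ B : Submodule k V, B ≤ A → (∀ g, B ≤ B.comap (π₀ g)) → B = ⊥ ∨ B = A)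
    (hHom0 : ∀ ψ : IntertwiningMap (π₀.subrepresentation A hAinv) (π₀.quotient A hAinv), ψ = 0)
    (hSchur : Module.finrank k (IntertwiningMap (π₀.subrepresentation A hAinv) (π₀.subrepresentation A hAinv)) = 1)
    (Φ : IntertwiningMap ρ ρ) (hΦfst : ∀ v : V × V, v.1 ∈ A → (Φ v).1 = v.1) (hΦsub : ∀ w ∈ A, Φ (0, w) = (0, -w))
    (τ : Representation k G X) (ι : IntertwiningMap (π₀.subrepresentation A hAinv) τ) (p : IntertwiningMap τ (π₀.subrepresentation A hAinv))
    (hp : Function.Surjective p) (hexact : LinearMap.ker p.toLinearMap = LinearMap.range ι.toLinearMap)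
    [FiniteDimensional k (IntertwiningMap τ π₀)]
    (halt : 2 ≤ Module.finrank k (IntertwiningMap τ π₀) ∨
      ∃ φ : X →ₗ[k] V × V, (∀ g x, φ (τ g x) = ρ g (φ x)) ∧ (∃ x, (φ x).1 ≠ 0) ∧ ∃ x, (φ x).1 = 0 ∧ (φ x).2 ≠ 0) :
    ∃ s : IntertwiningMap (π₀.subrepresentation A hAinv) τ, p.comp s = IntertwiningMap.id (π₀.subrepresentation A hAinv) := by
  rcases halt with hfin | ⟨φ, hφ, h₀, h₁⟩
  · exact exists_section_of_two_le_finrank π₀ A hAinv hAirr hHom0 hSchur τ ι p hp hexact hfin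
  · obtain ⟨hA, hmeet⟩ := window_of_forall_apply_mem π₀ π₁ ρ hρ A τ φ hφ
      (forall_apply_mem_of_selfExtension π₀ A hAinv hAirr hHom0 τ ι p hexact)
    exact exists_section_of_two_le_finrank π₀ A hAinv hAirr hHom0 hSchur τ ι p hp hexact
      (two_le_finrank_intertwiningMap_of_jet_sign π₀ π₁ ρ hρ A h2 Φ hΦfst hΦsub τ φ hφ hA hmeet h₀ h₁)

/-! ## §3 In JET-SIGN letters: a jet intertwiner `(𝒜₀, 𝒜₁)` with `A ≤ ker(𝒜₀ − 1)` -/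

/-- **THE JET SIGN OF `(𝒜₀, 𝒜₁)` ACTS BY `+1` OVER `A` ON THE QUOTIENT AND BY `−1` ON THE SUB COPY OF `A`** when `𝒜₀ = 1` on `A`: for `Φ (v₀, v₁) = (𝒜₀ v₀, −(𝒜₁ v₀ + 𝒜₀ v₁))`
(★ `exists_intertwiningMap_jet_sign`), `(Φ v).1 = v.1` if `v.1 ∈ A` and `Φ (0, w) = (0, −w)` if `w ∈ A`. [cite: Keys1984, §4 Thm. 3 p. 120 and Remark p. 129] -/
theorem exists_jet_sign_of_jet_intertwiner (π₀ : Representation k G V) (π₁ : G → Module.End k V) (ρ : Representation k G (V × V))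
    (hρ : ∀ g v₀ v₁, ρ g (v₀, v₁) = (π₀ g v₀, π₁ g v₀ + π₀ g v₁)) (A₀ A₁ : Module.End k V)
    (hA₀ : ∀ g, A₀ * π₀ g = π₀ g * A₀) (hA₁ : ∀ g, A₁ * π₀ g - π₀ g * A₁ = -(π₁ g * A₀ + A₀ * π₁ g))
    (A : Submodule k V) (hAfix : ∀ a ∈ A, A₀ a = a) :
    ∃ Φ : IntertwiningMap ρ ρ, (∀ v : V × V, v.1 ∈ A → (Φ v).1 = v.1) ∧ ∀ w ∈ A, Φ (0, w) = (0, -w) := by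
  obtain ⟨Φ, hΦ⟩ := exists_intertwiningMap_jet_sign π₀ π₁ ρ hρ A₀ A₁ hA₀ hA₁
  refine ⟨Φ, fun v hv => ?_, fun w hw => ?_⟩
  · rw [← Prod.mk.eta (p := v), hΦ]
    exact hAfix _ hv
  · rw [hΦ, map_zero, map_zero, zero_add, hAfix w hw]

/-- **K4′-alg ⟸ (J), generic form.**  Let `(𝒜₀, 𝒜₁)` be a jet intertwiner for `(π₀, π₁)` (`𝒜₀ ∈ End_G(π₀)`, `𝒜₁ π₀ g − π₀ g 𝒜₁ = −(π₁ g 𝒜₀ + 𝒜₀ π₁ g)`), `A ≤ ker(𝒜₀ − 1)` invariant and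
irreducible with `Hom_G(A, V ∕ A) = 0` and Schur, `2 ≠ 0` in `k`.  A self-extension `0 → A → X → A → 0` with `Hom_G(X, V)` finite-dimensional SPLITS as soon as
`2 ≤ dim Hom_G(X, V)` OR some equivariant `φ : X → V × V` into the jet module meets both the quotient and the sub. §2 with `Φ` := the jet sign (§3).
[cite: Keys1984, §3 pp. 118–119; §4 Thm. 3 p. 120 and Remark p. 129] [cite: Rogawski1990, §12.2 (3) p. 173] [cite: BernsteinZelevinsky1976, §2.1–§2.4; 2.8–2.9 p. 16] -/
theorem exists_section_of_two_le_finrank_or_exists_jet_of_jet_intertwiner (π₀ : Representation k G V) (π₁ : G → Module.End k V)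
    (ρ : Representation k G (V × V)) (hρ : ∀ g v₀ v₁, ρ g (v₀, v₁) = (π₀ g v₀, π₁ g v₀ + π₀ g v₁)) (A₀ A₁ : Module.End k V)
    (hA₀ : ∀ g, A₀ * π₀ g = π₀ g * A₀) (hA₁ : ∀ g, A₁ * π₀ g - π₀ g * A₁ = -(π₁ g * A₀ + A₀ * π₁ g))
    (A : Submodule k V) (hAfix : ∀ a ∈ A, A₀ a = a) (h2 : (2 : k) ≠ 0)
    (hAinv : ∀ g, A ≤ A.comap (π₀ g))
    (hAirr : ∀ B : Submodule k V, B ≤ A → (∀ g, B ≤ B.comap (π₀ g)) → B = ⊥ ∨ B = A)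
    (hHom0 : ∀ ψ : IntertwiningMap (π₀.subrepresentation A hAinv) (π₀.quotient A hAinv), ψ = 0)
    (hSchur : Module.finrank k (IntertwiningMap (π₀.subrepresentation A hAinv) (π₀.subrepresentation A hAinv)) = 1)
    (τ : Representation k G X) (ι : IntertwiningMap (π₀.subrepresentation A hAinv) τ) (p : IntertwiningMap τ (π₀.subrepresentation A hAinv))
    (hp : Function.Surjective p) (hexact : LinearMap.ker p.toLinearMap = LinearMap.range ι.toLinearMap)
    [FiniteDimensional k (IntertwiningMap τ π₀)]
    (halt : 2 ≤ Module.finrank k (IntertwiningMap τ π₀) ∨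
      ∃ φ : X →ₗ[k] V × V, (∀ g x, φ (τ g x) = ρ g (φ x)) ∧ (∃ x, (φ x).1 ≠ 0) ∧ ∃ x, (φ x).1 = 0 ∧ (φ x).2 ≠ 0) :
    ∃ s : IntertwiningMap (π₀.subrepresentation A hAinv) τ, p.comp s = IntertwiningMap.id (π₀.subrepresentation A hAinv) := by
  obtain ⟨Φ, hΦfst, hΦsub⟩ := exists_jet_sign_of_jet_intertwiner π₀ π₁ ρ hρ A₀ A₁ hA₀ hA₁ A hAfix
  exact exists_section_of_two_le_finrank_or_exists_jet_sign π₀ π₁ ρ hρ A h2 hAinv hAirr hHom0 hSchur Φ hΦfst hΦsub τ ι p hp hexact halt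

end Literature.RepresentationTheory
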